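import Literature.Geometry.Kaehler.ComplexTorusIntersectionMixedDiscriminant
import Literature.LinearAlgebra.Matrix.MixedDiscriminantVanishing
import HarnessLib

/-!
# When is an intersection number of semi-positive classes on a complex torus positive?
# (Panov's rank criterion read through `(L₁ · … · L_g) = r · D(H₁, …, H_g)`)

Layer `Literature/Geometry/Kaehler`, namespace `Literature.Geometry.Kaehler.ComplexTorus`; lane `lit-hodgefound`
(Track 2 foundations library), seat p16, generation 18 (row g18-#1, FILE 6 — the torus reading of FILE 5).
Imports the generation-17 bridge `ComplexTorusIntersectionMixedDiscriminant`
(`exists_torusIntegral_wedgeFamily_eq_mul_mixedDisc`: `∫_X (-η₀) ∧ ⋯ ∧ (-η_{g-1}) = r · mixedDisc (H_j)`, `r > 0`,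
for ANY complex basis) and `MixedDiscriminantVanishing` (Panov's criterion
`mixedDisc_re_pos_iff_forall_card_le_rank`, `mixedDisc_ne_zero_iff_forall_card_add_finrank_iInf_ker_le`).
Theorems only (no definition, no named fact; net debt 0).

## Sources

* R. B. Bapat, T. E. S. Raghavan, *Nonnegative Matrices and Applications* (1997) [BapatRaghavan1997], §5.2
  Theorem 5.2.2 (Panov): for positive semidefinite `A¹, …, Aⁿ`, "`D(A¹, …, Aⁿ) > 0`" iff "for any
  `T ⊂ {1, …, n}`, `rank (Σ_{i∈T} Aⁱ) ≥ |T|`" iff "`card (T) + dim {⋂_{i∈T} Null space of Aⁱ} ≤ n`"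
  (tree: `Literature.LinearAlgebra.Matrix.mixedDisc_re_pos_iff_forall_card_le_rank`).
* H. Lange, *Abelian Varieties over the Complex Numbers* (2023) [Lange2023AbelianVarietiesComplex], §2.2.1
  p. 89 ("`(L₁ · … · L_g) := ∫_X c₁(L₁) ∧ ⋯ ∧ c₁(L_g)`"), §2.2.5 Exercise (2) (semi-positive classes have
  `(L₁ · … · L_g) ≥ 0`; tree `torusIntegral_wedgeFamily_nonneg_of_semipos`), §1.2.2 Lemma 1.2.10 (the
  hermitian form `H` of a `(1,1)`-form and its Gram matrix, tree `hermGram`).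

## What is proved

For real invariant `2`-forms `η₀, …, η_{g-1}` of type `(1,1)` on `X = E/Λ` (`dim_ℂ X = g`), all SEMI-positive
(`η_j(iv, v) ≥ 0`), and any complex basis `b` of `E` (Gram matrices `H_j = hermGram η_j b ≥ 0`):

1. **`torusIntegral_wedgeFamily_pos_iff_forall_card_le_rank`**: `(L₁ · … · L_g) > 0` iff for every set `T`
   of indices `|T| ≤ rank H(Σ_{j∈T} η_j)` — Panov's (i) ⇔ (iii); the rank of the Gram matrix of the
   semi-positive form `Σ_{j∈T} η_j` does not depend on `b`. Complement:
   **`torusIntegral_wedgeFamily_eq_zero_iff_exists_rank_lt`** (`= 0` iff some `T` has `rank < |T|`), and the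
   null-space form **`torusIntegral_wedgeFamily_pos_iff_forall_card_add_finrank_ker_le`** ((i) ⇔ (ii):
   `|T| + dim ⋂_{j∈T} ker H_j ≤ g`, kernels of the Gram matrices in the coordinates of `b`).
2. **`torusIntegral_mixedFamily_pos_iff_le_rank`** (the NUMERICAL-DIMENSION criterion): for `η` semi-positive,
   `θ` positive (`θ(iv, v) > 0` for `v ≠ 0`) and `k ≤ g`, `(L^k · M^{g-k}) > 0` iff `k ≤ rank H(η)`
   (`L = -η`, `M = -θ`): the sets `T` meeting an `M`-slot have a positive definite Gram sum, and the sets of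
   `L`-slots only require `|T| ≤ rank H(η)` up to `|T| = k`.

All positivity statements are in `ℂ` with the `ComplexOrder` (`0 < ∫` means real and positive), as in the
tree's `torusIntegral_wedgeFamily_pos_of_pos`, which is the case "all `H_j` positive definite" of item 1.
-/

noncomputable section

open scoped Manifold Topology ComplexOrder ComplexConjugate MatrixOrder
open Set Function Complex Finset Module Matrix
open Literature.LinearAlgebra.Matrix

namespace Literature.Geometry.Kaehler

namespace ComplexTorus

/-! ## §1 Gram matrices of sums of forms; rank bookkeeping -/

section Gram

variable {E : Type*} [NormedAddCommGroup E] [NormedSpace ℂ E] {n : Type*}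

/-- The Gram matrix of the zero form vanishes. [cite: Lange2023AbelianVarietiesComplex, §1.2.2 Lemma 1.2.10] -/
theorem hermGram_zero (b : n → E) : hermGram (0 : E [⋀^Fin 2]→L[ℝ] ℝ) b = 0 := by
  ext i j
  simp [hermGram_apply, hermOf_apply]

/-- The Gram matrix is additive over finite sums of forms: `H(Σ_{j∈T} η_j) = Σ_{j∈T} H(η_j)`.
[cite: Lange2023AbelianVarietiesComplex, §1.2.2 Lemma 1.2.10] -/
theorem hermGram_finset_sum {κ : Type*} (η : κ → E [⋀^Fin 2]→L[ℝ] ℝ) (T : Finset κ) (b : n → E) :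
    hermGram (∑ j ∈ T, η j) b = ∑ j ∈ T, hermGram (η j) b := by
  classical
  induction T using Finset.induction_on with
  | empty => rw [Finset.sum_empty, Finset.sum_empty, hermGram_zero]
  | insert a T ha ih => rw [Finset.sum_insert ha, Finset.sum_insert ha, hermGram_add, ih]

end Gram

section Rank

variable {g : ℕ}

/-- Rank bookkeeping for the two-class family `(A on the first k slots, B on the others)` with `A ≥ 0` and
`B > 0`: Panov's condition `|T| ≤ rank Σ_{j∈T}` for all `T` holds iff `k ≤ rank A` (a set meeting a
`B`-slot has a positive definite sum of full rank `g ≥ |T|`; a set of `A`-slots has sum `|T| • A` of rank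
`rank A`, and `|T|` runs up to `k`). [cite: BapatRaghavan1997, §5.2 Theorem 5.2.2] -/
private theorem forall_card_le_rank_sum_ite_iff {A B : Matrix (Fin g) (Fin g) ℂ} (hA : A.PosSemidef)
    (hB : B.PosDef) {k : ℕ} (hk : k ≤ g) :
    (∀ T : Finset (Fin g), T.card ≤ (∑ j ∈ T, (if (j : ℕ) < k then A else B)).rank) ↔ k ≤ A.rank := by
  constructor
  · intro h
    -- take `T` = the `k` slots carrying `A`
    set T : Finset (Fin g) := Finset.univ.filter fun j : Fin g ↦ (j : ℕ) < k with hT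
    have hcard : T.card = k := by
      rw [hT, ← Fintype.card_subtype]
      -- `{j : Fin g // j < k} ≃ Fin k`
      rw [Fintype.card_fin_lt_of_le hk]
    have hsum : ∑ j ∈ T, (if (j : ℕ) < k then A else B) = k • A := by
      rw [Finset.sum_congr rfl fun j hj ↦ if_pos (Finset.mem_filter.1 hj).2, Finset.sum_const, hcard]
    have hle := h T
    rw [hcard, hsum] at hle
    rcases Nat.eq_zero_or_pos k with hk0 | hkpos
    · exact hk0 ▸ Nat.zero_le _
    · calc k ≤ (k • A).rank := hle
        _ = (((k : ℂ) • (1 : Matrix (Fin g) (Fin g) ℂ)) * A).rank := by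
            rw [Matrix.smul_mul, Matrix.one_mul, Nat.cast_smul_eq_nsmul]
        _ ≤ A.rank := Matrix.rank_mul_le_right _ _
  · intro h T
    by_cases hT : ∃ j ∈ T, ¬ (j : ℕ) < k
    · -- a `B`-slot: the sum is positive definite, of rank `g ≥ |T|`
      obtain ⟨j₀, hj₀, hj₀k⟩ := hT
      have hpd : (∑ j ∈ T, (if (j : ℕ) < k then A else B)).PosDef := by
        rw [← Finset.add_sum_erase T _ hj₀, if_neg hj₀k]
        exact hB.add_posSemidef (Matrix.posSemidef_sum _ fun j _ ↦ by
          split_ifs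
          · exact hA
          · exact hB.posSemidef)
      rw [Matrix.rank_of_isUnit _ hpd.isUnit, Fintype.card_fin]
      exact card_finset_fin_le T
    · -- only `A`-slots: the sum is `|T| • A`
      push Not at hT
      have hsum : ∑ j ∈ T, (if (j : ℕ) < k then A else B) = T.card • A := by
        rw [Finset.sum_congr rfl fun j hj ↦ if_pos (hT j hj), Finset.sum_const]
      have hTk : T.card ≤ k := by
        calc T.card ≤ (Finset.univ.filter fun j : Fin g ↦ (j : ℕ) < k).card :=
              Finset.card_le_card fun j hj ↦ Finset.mem_filter.2 ⟨Finset.mem_univ _, hT j hj⟩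
          _ = k := by rw [← Fintype.card_subtype, Fintype.card_fin_lt_of_le hk]
      rcases Nat.eq_zero_or_pos T.card with h0 | hpos
      · rw [h0]; exact Nat.zero_le _
      · rw [hsum]
        have hunit : IsUnit ((T.card : ℂ) • (1 : Matrix (Fin g) (Fin g) ℂ)).det := by
          rw [Matrix.det_smul, Matrix.det_one, mul_one]
          exact (pow_ne_zero _ (Nat.cast_ne_zero.2 hpos.ne')).isUnit
        calc T.card ≤ k := hTk
          _ ≤ A.rank := h
          _ = (((T.card : ℂ) • (1 : Matrix (Fin g) (Fin g) ℂ)) * A).rank :=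
              (Matrix.rank_mul_eq_right_of_isUnit_det _ _ hunit).symm
          _ = (T.card • A).rank := by rw [Matrix.smul_mul, Matrix.one_mul, Nat.cast_smul_eq_nsmul]

end Rank

/-! ## §2 The positivity criterion on the torus -/

section Torus

variable {ι : Type*} [Fintype ι] [DecidableEq ι] {E : Type*} [NormedAddCommGroup E] [NormedSpace ℂ E]
  (Φ : (ι → ℝ) ≃L[ℝ] E) {g : ℕ}

omit [DecidableEq ι] in
include Φ in
/-- `dim_ℂ E = g` when the lattice basis is enumerated by `Fin (2g)`. [folklore] -/
private theorem finrank_eq_of_equiv₆ (e : Fin (2 * g) ≃ ι) : finrank ℂ E = g := by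
  have h1 : finrank ℝ (ι → ℝ) = finrank ℝ E := LinearEquiv.finrank_eq (Φ : (ι → ℝ) ≃L[ℝ] E).toLinearEquiv
  have h2 := finrank_real_of_complex E
  have h3 : Fintype.card (Fin (2 * g)) = Fintype.card ι := Fintype.card_congr e
  rw [Module.finrank_fintype_fun_eq_card] at h1
  rw [Fintype.card_fin] at h3
  omega

/-- **Positivity criterion for intersection numbers of semi-positive classes on a complex torus**
(Panov's theorem, Bapat–Raghavan Thm. 5.2.2 (i) ⇔ (iii), read through `(L₁ · … · L_g) = r · D(H₁, …, H_g)`,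
`r > 0`): for semi-positive `(1,1)`-forms `η_j` and any complex basis `b`,
`∫_X (-η₀) ∧ ⋯ ∧ (-η_{g-1}) > 0` iff `|T| ≤ rank H(Σ_{j∈T} η_j)` for every set `T` of indices.
[cite: BapatRaghavan1997, §5.2 Theorem 5.2.2] [cite: Lange2023AbelianVarietiesComplex, §2.2.1 p. 89 and §2.2.5 Exercise (2)] -/
theorem torusIntegral_wedgeFamily_pos_iff_forall_card_le_rank (e : Fin (2 * g) ≃ ι) (b : Module.Basis (Fin g) ℂ E)
    (η : Fin g → E [⋀^Fin 2]→L[ℝ] ℝ) (h11 : ∀ j (x y : E), η j ![I • x, I • y] = η j ![x, y])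
    (hpsd : ∀ j (v : E), 0 ≤ η j ![I • v, v]) :
    0 < torusIntegral Φ e (wedgeFamily g (fun j ↦ ofRealForm (-(η j)))) ↔
      ∀ T : Finset (Fin g), T.card ≤ (hermGram (∑ j ∈ T, η j) ⇑b).rank := by
  obtain ⟨r, hr, hI⟩ := exists_torusIntegral_wedgeFamily_eq_mul_mixedDisc Φ e b
  have hM : ∀ j, (hermGram (η j) ⇑b).PosSemidef := fun j ↦ posSemidef_hermGram (h11 j) (hpsd j) _
  have hherm : mixedDisc (fun j ↦ hermGram (η j) ⇑b) = ((mixedDisc (fun j ↦ hermGram (η j) ⇑b)).re : ℂ) :=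
    mixedDisc_eq_re_of_isHermitian _ fun j ↦ (hM j).1
  rw [hI η h11]
  simp_rw [hermGram_finset_sum]
  rw [← mixedDisc_re_pos_iff_forall_card_le_rank _ hM, hherm, ← Complex.ofReal_mul, Complex.zero_lt_real]
  exact ⟨fun h ↦ pos_of_mul_pos_right h hr.le, fun h ↦ mul_pos hr h⟩

/-- **Vanishing criterion**: under the same hypotheses, `∫_X (-η₀) ∧ ⋯ ∧ (-η_{g-1}) = 0` iff some set `T`
of indices has `rank H(Σ_{j∈T} η_j) < |T|`. [cite: BapatRaghavan1997, §5.2 Theorem 5.2.2]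
[cite: Lange2023AbelianVarietiesComplex, §2.2.5 Exercise (2)] -/
theorem torusIntegral_wedgeFamily_eq_zero_iff_exists_rank_lt (e : Fin (2 * g) ≃ ι) (b : Module.Basis (Fin g) ℂ E)
    (η : Fin g → E [⋀^Fin 2]→L[ℝ] ℝ) (h11 : ∀ j (x y : E), η j ![I • x, I • y] = η j ![x, y])
    (hpsd : ∀ j (v : E), 0 ≤ η j ![I • v, v]) :
    torusIntegral Φ e (wedgeFamily g (fun j ↦ ofRealForm (-(η j)))) = 0 ↔
      ∃ T : Finset (Fin g), (hermGram (∑ j ∈ T, η j) ⇑b).rank < T.card := by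
  have hnn := torusIntegral_wedgeFamily_nonneg_of_semipos Φ e η h11 hpsd
  have hpos := torusIntegral_wedgeFamily_pos_iff_forall_card_le_rank Φ e b η h11 hpsd
  constructor
  · intro h0
    by_contra hne
    push Not at hne
    have := hpos.2 hne
    rw [h0] at this
    exact lt_irrefl _ this
  · rintro ⟨T, hT⟩
    rcases hnn.lt_or_eq with hlt | heq
    · exact absurd (hpos.1 hlt T) (not_le.2 hT)
    · exact heq.symm

/-- **Null-space form of the criterion** (Bapat–Raghavan Thm. 5.2.2 (i) ⇔ (ii): "`card (T) +
dim {⋂_{i∈T} Null space of Aⁱ} ≤ n`"): `∫_X (-η₀) ∧ ⋯ ∧ (-η_{g-1}) > 0` iff for every `T`,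
`|T| + dim_ℂ ⋂_{j∈T} ker H_j ≤ g`, the `H_j = hermGram η_j b` acting on coordinate vectors.
[cite: BapatRaghavan1997, §5.2 Theorem 5.2.2] [cite: Lange2023AbelianVarietiesComplex, §2.2.1 p. 89] -/
theorem torusIntegral_wedgeFamily_pos_iff_forall_card_add_finrank_ker_le (e : Fin (2 * g) ≃ ι)
    (b : Module.Basis (Fin g) ℂ E) (η : Fin g → E [⋀^Fin 2]→L[ℝ] ℝ)
    (h11 : ∀ j (x y : E), η j ![I • x, I • y] = η j ![x, y]) (hpsd : ∀ j (v : E), 0 ≤ η j ![I • v, v]) :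
    0 < torusIntegral Φ e (wedgeFamily g (fun j ↦ ofRealForm (-(η j)))) ↔
      ∀ T : Finset (Fin g),
        T.card + finrank ℂ ↥(⨅ j ∈ T, LinearMap.ker (hermGram (η j) ⇑b).mulVecLin) ≤ g := by
  have hM : ∀ j, (hermGram (η j) ⇑b).PosSemidef := fun j ↦ posSemidef_hermGram (h11 j) (hpsd j) _
  rw [torusIntegral_wedgeFamily_pos_iff_forall_card_le_rank Φ e b η h11 hpsd]
  refine forall_congr' fun T ↦ ?_
  rw [hermGram_finset_sum, ← card_add_finrank_iInf_ker_le_iff _ hM T, Fintype.card_fin]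

/-- **The numerical-dimension criterion** for a semi-positive class against a positive one: for `η`
semi-positive, `θ` positive, `k ≤ g` and any complex basis `b`,
`(L^k · M^{g-k}) = ∫_X (-η)^{∧k} ∧ (-θ)^{∧(g-k)} > 0` iff `k ≤ rank H(η)` (`L = -η`, `M = -θ`; the family is
the tree's `mixedFamily`). Panov's condition for this two-class family reduces to `k ≤ rank H(η)`
(`forall_card_le_rank_sum_ite_iff`). [cite: BapatRaghavan1997, §5.2 Theorem 5.2.2]
[cite: Lange2023AbelianVarietiesComplex, §2.2.1 p. 89 and §2.4.2 Prop. 2.4.13 (the numbers (L^k · M^{g-k}))] -/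
theorem torusIntegral_mixedFamily_pos_iff_le_rank (e : Fin (2 * g) ≃ ι) (b : Module.Basis (Fin g) ℂ E)
    (η θ : E [⋀^Fin 2]→L[ℝ] ℝ) (hη : ∀ x y : E, η ![I • x, I • y] = η ![x, y])
    (hθ : ∀ x y : E, θ ![I • x, I • y] = θ ![x, y]) (hηpsd : ∀ v : E, 0 ≤ η ![I • v, v])
    (hθpos : ∀ v : E, v ≠ 0 → 0 < θ ![I • v, v]) {k : ℕ} (hk : k ≤ g) :
    0 < torusIntegral Φ e (wedgeFamily g (mixedFamily (ofRealForm (-η)) (ofRealForm (-θ)) g k)) ↔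
      k ≤ (hermGram η ⇑b).rank := by
  -- the two-class family as a `Fin g`-family of real forms
  set ζ : Fin g → E [⋀^Fin 2]→L[ℝ] ℝ := fun j ↦ if (j : ℕ) < k then η else θ with hζ
  have hfam : mixedFamily (ofRealForm (-η)) (ofRealForm (-θ)) g k = fun j ↦ ofRealForm (-(ζ j)) := by
    funext j
    simp only [mixedFamily_apply, hζ]
    split_ifs <;> rfl
  have h11 : ∀ j (x y : E), ζ j ![I • x, I • y] = ζ j ![x, y] := fun j x y ↦ by
    simp only [hζ]; split_ifs; exacts [hη x y, hθ x y]
  have hpsd : ∀ j (v : E), 0 ≤ ζ j ![I • v, v] := fun j v ↦ by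
    simp only [hζ]; split_ifs; exacts [hηpsd v, apply_I_smul_self_nonneg_of_pos hθpos v]
  rw [hfam, torusIntegral_wedgeFamily_pos_iff_forall_card_le_rank Φ e b ζ h11 hpsd]
  have hG : ∀ T : Finset (Fin g), hermGram (∑ j ∈ T, ζ j) ⇑b =
      ∑ j ∈ T, (if (j : ℕ) < k then hermGram η ⇑b else hermGram θ ⇑b) := fun T ↦ by
    rw [hermGram_finset_sum]
    refine Finset.sum_congr rfl fun j _ ↦ ?_
    simp only [hζ]; split_ifs <;> rfl
  simp_rw [hG]
  exact forall_card_le_rank_sum_ite_iff (posSemidef_hermGram hη hηpsd _) ((posDef_hermGram_iff hθ b).2 hθpos) hk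

end Torus

end ComplexTorus

end Literature.Geometry.Kaehler

end
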